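import Summits.NavierStokesRegularity.NavierStokesRegularity.Theses.AxisymmetricExtremality
import Summits.NavierStokesRegularity.NavierStokesRegularity.Theorems.AxisymmetricExtremalityAxisymmetricKatoGlobalNoSwirlStratum
import Literature.Analysis.FluidPDE.AxisymmetricEuler

/-!
# Strategist census s17-g8 — typed attempts for crux `AxisymmetricKatoGlobal` (stmt-NavierStokesRegularity-15453)

Scratch file of the independent strategy census (family `s`). Every `def` is a candidate
replacement / piece / strengthening; every `theorem` is the (pure-logic) assembly showing how the
candidate would feed the route's `closes`. Nothing here is proposed to the tree.
-/

namespace Summit.NavierStokesRegularity.NavierStokesRegularity.Cruxes.AxisymmetricKatoGlobal.StrategistS17g8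

open Summit.NavierStokesRegularity.NavierStokesRegularity.Theses.AxisymmetricExtremality
open Literature.Analysis.FluidPDE Literature.Analysis.FunctionSpaces MeasureTheory

/-- ℝ³ and ℂ³ as in the route file. -/
abbrev E := EuclideanSpace ℝ (Fin 3)
abbrev EC := EuclideanSpace ℂ (Fin 3)

/-- The rotation-equivariance clause of the crux, verbatim (= `IsAxisymmetric u₀` unfolded). -/
def AxEq (u₀ : E → E) : Prop :=
  ∀ (θ : ℝ) (x : E), u₀ (WithLp.toLp 2 ![Real.cos θ * x 0 - Real.sin θ * x 1, Real.sin θ * x 0 + Real.cos θ * x 1, x 2]) =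
    WithLp.toLp 2 ![Real.cos θ * u₀ x 0 - Real.sin θ * u₀ x 1, Real.sin θ * u₀ x 0 + Real.cos θ * u₀ x 1, u₀ x 2]

theorem axEq_iff_isAxisymmetric (u₀ : E → E) : AxEq u₀ ↔ IsAxisymmetric u₀ := Iff.rfl

/-- The "critical datum" hypotheses of the crux, bundled. -/
def CritDatum (u₀ : E → E) (g : HomSobolev E EC (1 / 2 : ℝ)) : Prop :=
  MemLp u₀ 3 volume ∧ g.Represents (Literature.Analysis.FunctionSpaces.EuclideanSpace.complexify ∘ u₀) ∧ IsWeaklyDivFree u₀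

/-- The crux restated over the bundles (sanity: it is literally the route decl). -/
theorem crux_iff :
    AxisymmetricKatoGlobal ↔
      ∀ ν : ℝ, 0 < ν → ∀ (u₀ : E → E) (g : HomSobolev E EC (1 / 2 : ℝ)),
        CritDatum u₀ g → AxEq u₀ → HasGlobalKatoSolution ν u₀ := by
  constructor
  · intro h ν hν u₀ g ⟨h1, h2, h3⟩ hax
    exact h ν hν u₀ g h1 h2 h3 hax
  · intro h ν hν u₀ g h1 h2 h3 hax
    exact h ν hν u₀ g ⟨h1, h2, h3⟩ hax

/-! ## §1 Weaker intermediate read off the summit: the THRESHOLD instance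

`closes` applies the crux only to an axisymmetric Rusin–Šverák MINIMAL blow-up datum. -/

/-- W_thr: there is no axisymmetric `Ḣ^{1/2}`-minimal blow-up datum. Strictly weaker (as a
sentence) than the crux; exactly what `closes` consumes. -/
def AxisymMinimalDatumExcluded : Prop :=
  ∀ ν : ℝ, 0 < ν → ∀ (u₀ : E → E) (g : HomSobolev E EC (1 / 2 : ℝ)),
    IsMinimalBlowupDatum ν u₀ g → AxEq u₀ → False

/-- crux ⇒ W_thr (trivial direction). -/
theorem thr_of_crux (h : AxisymmetricKatoGlobal) : AxisymMinimalDatumExcluded := by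
  intro ν hν u₀ g hmin hax
  obtain ⟨hL3, hrep, hdiv, -, hnot⟩ := hmin
  exact hnot (h ν hν u₀ g hL3 hrep hdiv hax)

/-- W_thr suffices for the route: the deciding theorem re-proved with W_thr in place of the crux
(pure logic, mirror of `closes`). -/
theorem closes_of_thr (h₂ : MinimalDatumPFold) (h₄ : PFoldToAxisymmetric)
    (h₃ : AxisymMinimalDatumExcluded) : NavierStokesRegularity := by
  show Literature.NS.NavierStokesExistenceSmoothR3
  intro ν hν u₀ hsm hdiv hdec
  by_contra hno
  obtain ⟨u₁, g, hmin, hax⟩ := h₄ ν hν (h₂ ν hν ⟨u₀, hsm, hdiv, hdec, hno⟩)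
  exact h₃ ν hν u₁ g hmin hax

/-! ## §2 Decomposition template: every regularity CRITERION `P` splits the crux into
  (known)  `CriterionSuffices P`  : axisymmetric critical data satisfying `P` are global, and
  (open)   `BlowupSatisfies P`    : every axisymmetric critical datum WITHOUT a global Kato solution satisfies `P`,
with a proved two-piece assembly. Instances (P = Type I rate, `Γ`-modulus `|ln r|^{-3/2}` at the
axis, partial Type I `v_r ≥ -c/√(T-t)`, no swirl, small swirl …) are listed in the census; in
each the second piece is the whole crux. -/

/-- Piece 1 of the criterion split. -/
def CriterionSuffices (P : ℝ → (E → E) → Prop) : Prop :=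
  ∀ ν : ℝ, 0 < ν → ∀ (u₀ : E → E) (g : HomSobolev E EC (1 / 2 : ℝ)),
    CritDatum u₀ g → AxEq u₀ → P ν u₀ → HasGlobalKatoSolution ν u₀

/-- Piece 2 of the criterion split. -/
def BlowupSatisfies (P : ℝ → (E → E) → Prop) : Prop :=
  ∀ ν : ℝ, 0 < ν → ∀ (u₀ : E → E) (g : HomSobolev E EC (1 / 2 : ℝ)),
    CritDatum u₀ g → AxEq u₀ → ¬ HasGlobalKatoSolution ν u₀ → P ν u₀

/-- Assembly of the criterion split (proved): for ANY criterion `P`. -/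
theorem crux_of_criterion_split (P : ℝ → (E → E) → Prop)
    (h₁ : CriterionSuffices P) (h₂ : BlowupSatisfies P) : AxisymmetricKatoGlobal := by
  intro ν hν u₀ g hL3 hrep hdiv hax
  by_contra hno
  exact hno (h₁ ν hν u₀ g ⟨hL3, hrep, hdiv⟩ hax (h₂ ν hν u₀ g ⟨hL3, hrep, hdiv⟩ hax hno))

/-- Converse bookkeeping: piece 2 is implied by the crux for every `P` (so piece 2 is never
STRONGER than the crux; the census argues it is never materially weaker either, for the `P`
with a known piece 1). -/
theorem blowupSatisfies_of_crux (P : ℝ → (E → E) → Prop) (h : AxisymmetricKatoGlobal) :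
    BlowupSatisfies P := by
  intro ν hν u₀ g ⟨hL3, hrep, hdiv⟩ hax hno
  exact absurd (h ν hν u₀ g hL3 hrep hdiv hax) hno

/-- Instance `P = no swirl`: piece 1 is the LANDED stratum theorem (used by name). -/
theorem criterionSuffices_noSwirl : CriterionSuffices (fun _ u₀ => HasNoSwirl u₀) := by
  intro ν hν u₀ g ⟨hL3, _, hdiv⟩ hax hP
  exact Theorems.AxisymmetricKatoGlobal.NoSwirlStratum.axisymmetricKatoGlobal_noSwirl_stratum
    ν hν u₀ hL3 hdiv (fun θ x => hax θ x) hP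

/-- … so for `P = no swirl` the open piece says "every axisymmetric blow-up datum is swirl-free",
i.e. (contrapositively) every axisymmetric datum WITH swirl is global — the crux minus a landed
stratum. Recorded as the regime split `noSwirl ∨ swirl`. -/
def SwirlStratum : Prop :=
  ∀ ν : ℝ, 0 < ν → ∀ (u₀ : E → E) (g : HomSobolev E EC (1 / 2 : ℝ)),
    CritDatum u₀ g → AxEq u₀ → ¬ HasNoSwirl u₀ → HasGlobalKatoSolution ν u₀

theorem crux_of_swirlStratum (h : SwirlStratum) : AxisymmetricKatoGlobal := by
  intro ν hν u₀ g hL3 hrep hdiv hax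
  by_cases hs : HasNoSwirl u₀
  · exact criterionSuffices_noSwirl ν hν u₀ g ⟨hL3, hrep, hdiv⟩ hax hs
  · exact h ν hν u₀ g ⟨hL3, hrep, hdiv⟩ hax hs

/-! ## §3 Strengthenings S⁺ (each implies the crux by a proved one-liner) -/

/-- S⁺_quant: global Kato solution WITH an a-priori bound `B ν u₀` (e.g. a bound of
`sup_t ‖u(t)‖_{L³}` by a function of `‖g‖_{Ḣ^{1/2}}`), schematic in the bound. -/
def StrengthenedWithBound (B : ℝ → (E → E) → Prop) : Prop :=
  ∀ ν : ℝ, 0 < ν → ∀ (u₀ : E → E) (g : HomSobolev E EC (1 / 2 : ℝ)),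
    CritDatum u₀ g → AxEq u₀ → HasGlobalKatoSolution ν u₀ ∧ B ν u₀

theorem crux_of_strengthenedWithBound (B : ℝ → (E → E) → Prop)
    (h : StrengthenedWithBound B) : AxisymmetricKatoGlobal := by
  intro ν hν u₀ g hL3 hrep hdiv hax
  exact (h ν hν u₀ g ⟨hL3, hrep, hdiv⟩ hax).1

/-- S⁺_L3: drop the `Ḣ^{1/2}` representative (data merely in `L³`, weakly divergence-free,
axisymmetric). Stronger; same open problem. -/
def StrengthenedL3 : Prop :=
  ∀ ν : ℝ, 0 < ν → ∀ (u₀ : E → E), MemLp u₀ 3 volume → IsWeaklyDivFree u₀ → AxEq u₀ →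
    HasGlobalKatoSolution ν u₀

theorem crux_of_strengthenedL3 (h : StrengthenedL3) : AxisymmetricKatoGlobal := by
  intro ν hν u₀ g hL3 _ hdiv hax
  exact h ν hν u₀ hL3 hdiv hax

/-! ## §4 Negation: the shape of a counterexample -/

/-- ¬crux unfolded: an axisymmetric critical datum without a global Kato solution. -/
theorem not_crux_iff :
    ¬ AxisymmetricKatoGlobal ↔
      ∃ ν : ℝ, 0 < ν ∧ ∃ (u₀ : E → E) (g : HomSobolev E EC (1 / 2 : ℝ)),
        CritDatum u₀ g ∧ AxEq u₀ ∧ ¬ HasGlobalKatoSolution ν u₀ := by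
  rw [crux_iff]
  push_neg
  constructor
  · rintro ⟨ν, hν, u₀, g, hc, hax, hno⟩
    exact ⟨ν, hν, u₀, g, hc, hax, hno⟩
  · rintro ⟨ν, hν, u₀, g, hc, hax, hno⟩
    exact ⟨ν, hν, u₀, g, hc, hax, hno⟩

/-- Forced structure (landed part): a counterexample datum must carry swirl. -/
theorem counterexample_has_swirl {ν : ℝ} (hν : 0 < ν) {u₀ : E → E} {g : HomSobolev E EC (1 / 2 : ℝ)}
    (hc : CritDatum u₀ g) (hax : AxEq u₀) (hno : ¬ HasGlobalKatoSolution ν u₀) : ¬ HasNoSwirl u₀ :=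
  fun hs => hno (criterionSuffices_noSwirl ν hν u₀ g hc hax hs)

end Summit.NavierStokesRegularity.NavierStokesRegularity.Cruxes.AxisymmetricKatoGlobal.StrategistS17g8
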